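import Summits.QuantumFields.BalabanUV.InfraRed.StrongCouplingVarianceDoorSUN
import Summits.QuantumFields.BalabanUV.InfraRed.StrongCouplingSharpWindow
import HarnessLib

/-!
# The Poincaré door for `SU(N)`: the one-link modulus from a NAMED Poincaré constant and a NAMED variance bound

Observatory of the non-perturbative crossover; no mass-gap claim.

ABSOLUTE RULE of this package: no internally-minted statement enters as a cited fact; every hypothesis is either
kernel-proved in this package or a verbatim quotation of a PUBLISHED theorem with page reference. The manuscript(s)
under audit are not citable for their own disputed steps. Everything below is kernel arithmetic over theorems of this
tree; the one new object is a HYPOTHESIS SCHEMA (a `def … : Prop`, nothing asserted).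

WHAT THIS LEAF DOES.  The variance door `StrongCouplingVarianceDoorSUN` (leaf (38) of the cell's FRONT-SC) bounds the
test-function factor of `|Cov_{ν}(φ, w)| ≤ (Var φ · Var w)^{1/2}` by the Bakry–Émery Poincaré inequality
`haarPoincare_SU` (`Var ≤ M²/(N(1/2 − ‖B‖_op))`), which carries the RADIUS CAP `R < 1/2` and is `16/9` off the Haar
value already at `B = 0` (`2/N` against `1/λ₁ = N/(N² − 1)`, `λ₁ = (N² − 1)/N` the first eigenvalue of `−Δ_{SU(N)}` in
the metric `Re tr(X Y^*)`).  This leaf names that factor too, for general `N`: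

* `OneLinkPoincareSUN N R c` (schema): for every `B` with `‖B‖_op ≤ R` and every `M`-Lipschitz `ψ` (Frobenius distance),
  `Var_{ν_B}(ψ) ≤ c M²`, `ν_B(dg) ∝ exp(N Re tr(g B)) dg` on `SU(N)` — the `N`-general twin of the tree's
  `OneLinkPoincareSU2 R c` (`oneLinkPoincareSUN_two_iff`: at `N = 2` it IS that schema, so the tree's sharp theorem
  `oneLinkPoincareSU2_sharp` inhabits it with the Haar constant `2/3` for EVERY `R`, `oneLinkPoincareSUN_two_sharp`);
* `oneLinkPoincareSUN_bakryEmery` (K): Bakry–Émery inhabits it with `c = 1/(N(1/2 − R))` on `R < 1/2`;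
* `oneLinkKRModulus_of_poincare_of_varianceBound` (K): `OneLinkPoincareSUN N R c`, `OneLinkVarianceBound N R v`
  (`0 ≤ c`, `0 ≤ v`) ⟹ `OneLinkKRModulus N R √(c v)` — NO radius cap, no `N ≥ 2`; with the Bakry–Émery `c` this is
  leaf (38)'s modulus `√(v/(N(1/2 − R)))` again (`oneLinkKRModulus_of_varianceBound_again`), so unconditionally nothing
  moves;
* `strongCouplingFronts_SU_of_poincare_of_varianceBound` (K): the three gauge-fixed doors (row constants `18`,
  `14223/1000`, `14` of `StrongCouplingSUNFronts`) at tree coupling `β`, radius `6β/N`: SC-a / SC-b / SC-c as soon as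
  `D (β/N) √(c v) < 1`; `su3_fronts_of_poincare_of_varianceBound`: the same in Wilson units for `SU(3)`
  (`β_W = 6/g²`, 't Hooft `β_W/9`, radius `2β_W/3`), squared doors `(D β_W/9)² c v < 1`;
* `SU(3)` CONDITIONAL instances (K, BOTH hypotheses displayed in the statement): IF `OneLinkPoincareSUN 3 (1/3) (3/5)`
  and `OneLinkVarianceBound 3 (1/3) (5/2)` THEN SC-b and SC-c hold at Wilson `β_W = 1/2`
  (`su3_fronts_half_of_poincare_of_varianceBound`); IF `OneLinkPoincareSUN 3 (4/15) (3/5)` and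
  `OneLinkVarianceBound 3 (4/15) (9/4)` THEN SC-a holds at `β_W = 2/5` (`su3_dlrMassGapAt_twoFifths_of_poincare_of_varianceBound`).
  The constants are TARGETS for a later two-engine certificate, chosen with margin from a reconnaissance of this lineage
  (first-order perturbation theory of the ground-state transform `−Δ + ¼|∇V|² + ½ΔV`, `V = 3 Re tr(gB)`: along `B = s·1`
  the first excited level `8/3` of `−Δ_{SU(3)}` splits as `8/3 ± 2s`, `8/3 ± s`, because `E_Haar[g_{ai} g_{bj} g_{ck}] =
  ε_{abc} ε_{ijk}/6 ≠ 0` couples the `3` and `3̄` coefficient blocks at first order — unlike `SU(2)`, the gap DROPS under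
  tilting; Monte Carlo values of the linear variance `sup Var_{ν_B}(3 Re tr gΔ) ≈ 1.94 ∕ 2.16 ∕ 2.36` at `R = 0.2 ∕ 0.3 ∕
  0.4`, `‖Δ‖_F = 1`) — NUMERICS, NOT EVIDENCE.

NOT CLAIMED: that `OneLinkPoincareSUN 3 R c` holds for any `c < 1/(3(1/2 − R))`, or for any `c` at all when `R ≥ 1/2`;
any `SU(3)` window beyond the hypothesis-free ones of `StrongCouplingSUNFronts` (`β_W < 3/16 ∕ 4500/20223 ∕ 9/40`);
anything new about `SU(2)`.  Necessary size of `c` [analysis, not used]: `B = 0` lies in every ball, so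
`c ≥ N/(N² − 1)` (`= 3/8` for `SU(3)`); for `SU(3)` the Haar value is NOT expected on any ball of positive radius
(first-order splitting above), in contrast with `oneLinkPoincareSU2_sharp`.

## References

* H. Shen, R. Zhu, X. Zhu, *A stochastic analysis approach to lattice Yang–Mills at strong coupling*, CMP 400 (2023),
  arXiv:2204.12737: Lemma 4.1, (4.4)–(4.6), Rem. 1.3 (the Bakry–Émery one-link bound); Cor. «Mass gap».
* H. Föllmer, *Random fields and diffusion processes*, LNM 1362 (1988), Thm. 2.13 (Dobrushin's covariance estimate).
-/

noncomputable section

open MeasureTheory ProbabilityTheory Real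
open Literature.MathematicalPhysics.QuantumFieldTheory
open Literature.MathematicalPhysics.QuantumLattice (fundamentalRep fundamentalLatticeRep)
open Literature.MathematicalPhysics.QuantumFieldTheory.Balaban1983to89
open Literature.MathematicalPhysics.QuantumFieldTheory.Balaban1983to89.StrongCouplingDobrushinWindow
open Literature.MathematicalPhysics.QuantumFieldTheory.Balaban1983to89.StrongCouplingTorusWindow (krRate krRate_pos)
open Literature.MathematicalPhysics.QuantumFieldTheory.Balaban1983to89.StrongCouplingKernelWindow
  (abs_integral_tilted_add_sub_le_of_cov)
open Summit.QuantumFields.BalabanUV.InfraRed.StrongCouplingVarianceDoorSUN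
open Summit.QuantumFields.BalabanUV.InfraRed.StrongCouplingPoincareWindow (OneLinkPoincareSU2)
open Summit.QuantumFields.BalabanUV.InfraRed.StrongCouplingSharpWindow (oneLinkPoincareSU2_sharp)

namespace Summit.QuantumFields.BalabanUV.InfraRed.StrongCouplingPoincareDoorSUN

/-! ## 1. The schema, its known inhabitants, and the modulus it gives -/

/-- **One-link Poincaré constant** (HYPOTHESIS SCHEMA, nothing asserted): on the operator-norm ball `‖B‖_op ≤ R` of
`M_N(ℂ)`, every `M`-Lipschitz observable `ψ` (Frobenius distance on `SU(N)`) has variance at most `c M²` under the tilted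
one-link law `ν_B(dg) ∝ exp(N Re tr(g B)) Haar(dg)`.  A spectral-gap lower bound `λ` for `ν_B` (embedding metric
`Re tr(X Y^*)`) gives it with `c = 1/λ`; Bakry–Émery gives `c = 1/(N(1/2 − R))` on `R < 1/2`
(`oneLinkPoincareSUN_bakryEmery`); the Haar point forces `c ≥ N/(N² − 1)`.  At `N = 2` this is the tree's
`OneLinkPoincareSU2 R c` (`oneLinkPoincareSUN_two_iff`). [folklore] -/
@[conjecture]
def OneLinkPoincareSUN (N : ℕ) (R c : ℝ) : Prop :=
  ∀ B : Matrix (Fin N) (Fin N) ℂ, matrixOpNorm B ≤ R →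
    ∀ (ψ : Matrix.specialUnitaryGroup (Fin N) ℂ → ℝ) (M : ℝ), 0 ≤ M →
      (∀ a b : Matrix.specialUnitaryGroup (Fin N) ℂ, |ψ a - ψ b| ≤ M * suFrobDist a b) →
      Var[ψ ; (haarProbability (Matrix.specialUnitaryGroup (Fin N) ℂ)).tilted
        fun g => (N : ℝ) * ((g : Matrix (Fin N) (Fin N) ℂ) * B).trace.re] ≤ c * M ^ 2

/-- The schema is monotone: a constant valid on a larger ball is valid on a smaller ball, and a larger constant is
weaker. [folklore] -/
theorem OneLinkPoincareSUN.mono {N : ℕ} {R R' c c' : ℝ} (h : OneLinkPoincareSUN N R c) (hR : R' ≤ R)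
    (hc : c ≤ c') : OneLinkPoincareSUN N R' c' := fun B hB ψ M hM hψ =>
  (h B (hB.trans hR) ψ M hM hψ).trans (mul_le_mul_of_nonneg_right hc (sq_nonneg _))

/-- **Bakry–Émery inhabits the schema**: for `N ≥ 2` and `R < 1/2`, `OneLinkPoincareSUN N R (1/(N(1/2 − R)))` — the
tree's `haarPoincare_SU` verbatim, the pointwise constant `1/(N(1/2 − ‖B‖_op))` bounded on the ball.
[cite: arXiv220412737, Lemma 4.1 with (4.4)-(4.6) and Rem. 1.3] -/
theorem oneLinkPoincareSUN_bakryEmery {N : ℕ} (hN : 2 ≤ N) {R : ℝ} (hR : R < 1 / 2) :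
    OneLinkPoincareSUN N R (1 / ((N : ℝ) * (1 / 2 - R))) := by
  intro B hB ψ M hM hψ
  have hN0 : (0 : ℝ) < N := by exact_mod_cast (show 0 < N by omega)
  have hBlt : matrixOpNorm B < 1 / 2 := lt_of_le_of_lt hB hR
  have hvar := SUNBakryEmery.haarPoincare_SU hN B hBlt ψ M hM hψ
  refine hvar.trans ?_
  have h1 : 0 < 1 / 2 - matrixOpNorm B := by linarith
  have h2 : 0 < 1 / 2 - R := by linarith
  rw [one_div_mul_eq_div]
  exact div_le_div_of_nonneg_left (sq_nonneg M) (mul_pos hN0 h2) (mul_le_mul_of_nonneg_left (by linarith) hN0.le)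

/-- **At `N = 2` the schema is the tree's `OneLinkPoincareSU2`** (`StrongCouplingPoincareWindow`), whose potential
`pot B = 2 Re tr(· B)` is the `N = 2` case of `N Re tr(· B)`. [folklore] -/
theorem oneLinkPoincareSUN_two_iff {R c : ℝ} : OneLinkPoincareSUN 2 R c ↔ OneLinkPoincareSU2 R c := by
  have hpot : ∀ B : Matrix (Fin 2) (Fin 2) ℂ, StrongCouplingVarianceWindow.pot B =
      fun g : Matrix.specialUnitaryGroup (Fin 2) ℂ => ((2 : ℕ) : ℝ) * ((g : Matrix (Fin 2) (Fin 2) ℂ) * B).trace.re := by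
    intro B
    funext g
    simp [StrongCouplingVarianceWindow.pot]
  constructor
  · intro h B hB ψ M hM hψ
    rw [hpot B]
    exact h B hB ψ M hM hψ
  · intro h B hB ψ M hM hψ
    have h' := h B hB ψ M hM hψ
    rw [hpot B] at h'
    exact h'

/-- **For `SU(2)` the schema holds with the HAAR constant on every ball**: `OneLinkPoincareSUN 2 R (2/3)` for every `R`
— the tree's hypothesis-free `oneLinkPoincareSU2_sharp` (J-SC13: tilting never lowers the Poincaré constant of `S³`).
Recorded as the consistency check of the schema; nothing of the kind is claimed for `N ≥ 3`. [folklore] -/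
theorem oneLinkPoincareSUN_two_sharp (R : ℝ) : OneLinkPoincareSUN 2 R (2 / 3) :=
  oneLinkPoincareSUN_two_iff.2 (oneLinkPoincareSU2_sharp R)

/-- **The Poincaré–variance modulus.**  `OneLinkPoincareSUN N R c` and `OneLinkVarianceBound N R v` with `0 ≤ c`,
`0 ≤ v` give `OneLinkKRModulus N R √(c v)`: the covariance form of the tilt interpolation
(`abs_integral_tilted_add_sub_le_of_cov`) along `B_t = B + t(B' − B)` (the ball is convex), Cauchy–Schwarz
(`abs_integral_mul_sub_le_of_variance_le` with `Var φ ≤ (√c L)²`, `Var w ≤ (√v ‖B' − B‖_F)²`), the Poincaré HYPOTHESIS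
for the test function `φ` at `B_t` and the variance HYPOTHESIS for the linear observable `w = N Re tr(g(B' − B))` at
`B_t`.  Leaf (38)'s `oneLinkKRModulus_of_varianceBound` with `haarPoincare_SU` replaced by the schema — hence no radius
cap and no `N ≥ 2`. [cite: Follmer1988, Ch. I Theorem (2.13)] -/
theorem oneLinkKRModulus_of_poincare_of_varianceBound {N : ℕ} {R c v : ℝ} (hc : 0 ≤ c) (hv0 : 0 ≤ v)
    (hP : OneLinkPoincareSUN N R c) (hv : OneLinkVarianceBound N R v) :
    OneLinkKRModulus N R (Real.sqrt (c * v)) := by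
  classical
  intro B B' hB hB' φ L hφm hφb hL hφL
  have hN0 : (0 : ℝ) ≤ N := Nat.cast_nonneg N
  have hsc : 0 ≤ Real.sqrt c := Real.sqrt_nonneg _
  have hsv : 0 ≤ Real.sqrt v := Real.sqrt_nonneg _
  have hscv : Real.sqrt c * Real.sqrt v = Real.sqrt (c * v) := (Real.sqrt_mul hc v).symm
  -- the potentials
  have hfw : (fun g : Matrix.specialUnitaryGroup (Fin N) ℂ =>
      (N : ℝ) * ((g : Matrix (Fin N) (Fin N) ℂ) * B').trace.re) =
      fun g : Matrix.specialUnitaryGroup (Fin N) ℂ => (N : ℝ) * ((g : Matrix (Fin N) (Fin N) ℂ) * B).trace.re +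
        (N : ℝ) * ((g : Matrix (Fin N) (Fin N) ℂ) * (B' - B)).trace.re := by
    funext g
    simp only [Matrix.mul_sub, Matrix.trace_sub, Complex.sub_re]
    ring
  rw [hfw, abs_sub_comm]
  have hfm : Measurable fun g : Matrix.specialUnitaryGroup (Fin N) ℂ =>
      (N : ℝ) * ((g : Matrix (Fin N) (Fin N) ℂ) * B).trace.re :=
    (continuous_const.mul (continuous_re_trace_su_mul B)).measurable
  have hwm : Measurable fun g : Matrix.specialUnitaryGroup (Fin N) ℂ =>
      (N : ℝ) * ((g : Matrix (Fin N) (Fin N) ℂ) * (B' - B)).trace.re :=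
    (continuous_const.mul (continuous_re_trace_su_mul (B' - B))).measurable
  have hfb : ∃ C, ∀ s : Matrix.specialUnitaryGroup (Fin N) ℂ,
      |(N : ℝ) * ((s : Matrix (Fin N) (Fin N) ℂ) * B).trace.re| ≤ C :=
    ⟨(N : ℝ) * (Real.sqrt N * frobNorm B), fun s => by
      rw [abs_mul, abs_of_nonneg hN0]
      exact mul_le_mul_of_nonneg_left (abs_re_trace_su_mul_le s B) hN0⟩
  have hwb : ∀ s : Matrix.specialUnitaryGroup (Fin N) ℂ,
      |(N : ℝ) * ((s : Matrix (Fin N) (Fin N) ℂ) * (B' - B)).trace.re| ≤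
        (N : ℝ) * (Real.sqrt N * frobNorm (B' - B)) := fun s => by
    rw [abs_mul, abs_of_nonneg hN0]
    exact mul_le_mul_of_nonneg_left (abs_re_trace_su_mul_le s _) hN0
  have key := abs_integral_tilted_add_sub_le_of_cov
    (μ := haarProbability (Matrix.specialUnitaryGroup (Fin N) ℂ))
    (A := Real.sqrt (c * v) * L * frobNorm (B' - B)) hfm hfb hwm hwb hφm hφb ?_
  · rw [frobNorm_sub_comm]; exact key
  · intro t ht
    -- the interpolated tilt is the one-link law at `B_t`, `‖B_t‖_op ≤ R`
    set Bt : Matrix (Fin N) (Fin N) ℂ := B + (t : ℂ) • (B' - B) with hBt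
    have hft : (fun u : Matrix.specialUnitaryGroup (Fin N) ℂ =>
        (N : ℝ) * ((u : Matrix (Fin N) (Fin N) ℂ) * B).trace.re +
          t * ((N : ℝ) * ((u : Matrix (Fin N) (Fin N) ℂ) * (B' - B)).trace.re)) =
        fun g : Matrix.specialUnitaryGroup (Fin N) ℂ => (N : ℝ) * ((g : Matrix (Fin N) (Fin N) ℂ) * Bt).trace.re := by
      funext g
      simp only [hBt, Matrix.mul_add, Matrix.mul_smul, Matrix.trace_add, Matrix.trace_smul, Complex.add_re,
        smul_eq_mul, Complex.re_ofReal_mul]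
      ring
    have hBt_le : matrixOpNorm Bt ≤ R := by
      have h1 : Bt = ((1 - t : ℝ) : ℂ) • B + ((t : ℝ) : ℂ) • B' := by
        rw [hBt]
        push_cast
        simp only [smul_sub, sub_smul, one_smul]
        abel
      rw [h1]
      calc matrixOpNorm (((1 - t : ℝ) : ℂ) • B + ((t : ℝ) : ℂ) • B')
          ≤ matrixOpNorm (((1 - t : ℝ) : ℂ) • B) + matrixOpNorm (((t : ℝ) : ℂ) • B') := matrixOpNorm_add_le _ _
        _ = (1 - t) * matrixOpNorm B + t * matrixOpNorm B' := by
            rw [matrixOpNorm_smul, matrixOpNorm_smul, Complex.norm_real, Complex.norm_real, Real.norm_eq_abs,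
              Real.norm_eq_abs, abs_of_nonneg (by linarith [ht.2]), abs_of_nonneg ht.1]
        _ ≤ (1 - t) * R + t * R :=
            add_le_add (mul_le_mul_of_nonneg_left hB (by linarith [ht.2])) (mul_le_mul_of_nonneg_left hB' ht.1)
        _ = R := by ring
    rw [hft]
    set F : Matrix.specialUnitaryGroup (Fin N) ℂ → ℝ :=
      fun g => (N : ℝ) * ((g : Matrix (Fin N) (Fin N) ℂ) * Bt).trace.re with hFdef
    set ν : Measure (Matrix.specialUnitaryGroup (Fin N) ℂ) :=
      Measure.tilted (haarProbability (Matrix.specialUnitaryGroup (Fin N) ℂ)) F with hν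
    have hFm : Measurable F := (continuous_const.mul (continuous_re_trace_su_mul Bt)).measurable
    have hFb : ∀ s, |F s| ≤ (N : ℝ) * (Real.sqrt N * frobNorm Bt) := fun s => by
      simp only [hFdef]
      rw [abs_mul, abs_of_nonneg hN0]
      exact mul_le_mul_of_nonneg_left (abs_re_trace_su_mul_le s Bt) hN0
    have hexpF : Integrable (fun s => exp (F s)) (haarProbability (Matrix.specialUnitaryGroup (Fin N) ℂ)) :=
      integrable_of_measurable_of_abs_le hFm.exp (C := exp ((N : ℝ) * (Real.sqrt N * frobNorm Bt))) fun s => by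
        rw [abs_of_nonneg (exp_pos _).le]; exact exp_le_exp.2 ((le_abs_self _).trans (hFb s))
    haveI : IsProbabilityMeasure ν := isProbabilityMeasure_tilted hexpF
    -- the variance of the test function: the Poincaré HYPOTHESIS at `B_t`
    have hVφ : ∫ s, (φ s - ∫ s', φ s' ∂ν) ^ 2 ∂ν ≤ (Real.sqrt c * L) ^ 2 / 1 := by
      have hvar := hP Bt hBt_le φ L hL hφL
      rw [variance_eq_integral hφm.aemeasurable] at hvar
      rw [div_one, mul_pow, Real.sq_sqrt hc]
      exact hvar
    -- the variance of the linear observable: the variance HYPOTHESIS at `B_t`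
    have hVw : ∫ s, ((N : ℝ) * ((s : Matrix (Fin N) (Fin N) ℂ) * (B' - B)).trace.re -
        ∫ s', (N : ℝ) * ((s' : Matrix (Fin N) (Fin N) ℂ) * (B' - B)).trace.re ∂ν) ^ 2 ∂ν ≤
        (Real.sqrt v * frobNorm (B' - B)) ^ 2 / 1 := by
      have hvt := hv Bt hBt_le (B' - B)
      rw [variance_eq_integral hwm.aemeasurable] at hvt
      rw [div_one, mul_pow, Real.sq_sqrt hv0]
      exact hvt
    -- Cauchy–Schwarz
    have hcov := abs_integral_mul_sub_le_of_variance_le (ν := ν) one_pos (mul_nonneg hsc hL)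
      (mul_nonneg hsv (frobNorm_nonneg _)) hφm hφb hwm ⟨_, hwb⟩ hVφ hVw
    refine hcov.trans (le_of_eq ?_)
    rw [div_one, ← hscv]
    ring

/-- Consistency: with the Bakry–Émery constant `c = 1/(N(1/2 − R))` the Poincaré–variance modulus `√(c v)` IS leaf
(38)'s variance modulus `√(v/(N(1/2 − R)))` — `oneLinkKRModulus_of_varianceBound` re-derived through the schema;
unconditionally the Poincaré door moves nothing. [folklore] -/
theorem oneLinkKRModulus_of_varianceBound_again {N : ℕ} (hN : 2 ≤ N) {R v : ℝ} (hR : R < 1 / 2) (hv0 : 0 ≤ v)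
    (hv : OneLinkVarianceBound N R v) :
    OneLinkKRModulus N R (Real.sqrt (v / ((N : ℝ) * (1 / 2 - R)))) := by
  have hN0 : (0 : ℝ) < N := by exact_mod_cast (show 0 < N by omega)
  have h12 : 0 < 1 / 2 - R := by linarith
  have h := oneLinkKRModulus_of_poincare_of_varianceBound (le_of_lt (one_div_pos.2 (mul_pos hN0 h12))) hv0
    (oneLinkPoincareSUN_bakryEmery hN hR) hv
  rwa [one_div_mul_eq_div] at h

/-! ## 2. The three doors fed with the Poincaré–variance modulus -/

/-- **The three gauge-fixed doors for `SU(N)` with the Poincaré–variance modulus**: `OneLinkPoincareSUN N (6β/N) c`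
and `OneLinkVarianceBound N (6β/N) v` (tree coupling `β ≥ 0`, 't Hooft `β/N`) give SC-a / SC-b / SC-c at `β` as soon
as `D (β/N) √(c v) < 1`, `D = 18 ∕ 14223/1000 ∕ 14` (`strongCouplingFronts_SU_of_modulus` of leaf (38)).  No radius
cap: the Bakry–Émery bound `6β/N < 1/2` constrains only which `c` one can presently prove.
[cite: Follmer1988, Ch. I Theorem (2.13)] -/
theorem strongCouplingFronts_SU_of_poincare_of_varianceBound {N : ℕ} (hN : 2 ≤ N) {β c v : ℝ} (h0 : 0 ≤ β)
    (hc : 0 ≤ c) (hv0 : 0 ≤ v) (hP : OneLinkPoincareSUN N (β / N * 6) c)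
    (hv : OneLinkVarianceBound N (β / N * 6) v) :
    (18 * (β / N) * Real.sqrt (c * v) < 1 → DLRMassGapAt 4 N (β / N)) ∧
      (14223 / 1000 * (β / N) * Real.sqrt (c * v) < 1 →
          CrossoverLedger.StrongCouplingFront (fundamentalLatticeRep N) β) ∧
        (14 * (β / N) * Real.sqrt (c * v) < 1 →
          CrossoverLedger.LatticeMassGap (fundamentalRep (Fin N)) β (krRate (14 * (β / N) * Real.sqrt (c * v)))) :=
  strongCouplingFronts_SU_of_modulus hN h0 (Real.sqrt_nonneg _) le_rfl
    (oneLinkKRModulus_of_poincare_of_varianceBound hc hv0 hP hv)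

/-- **`SU(3)` in Wilson units** (`β_W = 6/g²`, tree coupling `β_W/3`, 't Hooft `β_W/9`, radius `2β_W/3`): the three
doors in squared form, `(D β_W/9)² (c v) < 1` ⟹ SC-a ∕ SC-b ∕ SC-c at `β_W`, from `OneLinkPoincareSUN 3 (2β_W/3) c` and
`OneLinkVarianceBound 3 (2β_W/3) v`.  This is the statement a later certificate of the two constants plugs into.
[folklore] -/
theorem su3_fronts_of_poincare_of_varianceBound {βW c v : ℝ} (h0 : 0 ≤ βW) (hc : 0 ≤ c) (hv0 : 0 ≤ v)
    (hP : OneLinkPoincareSUN 3 (2 * βW / 3) c) (hv : OneLinkVarianceBound 3 (2 * βW / 3) v) :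
    ((18 * (βW / 9)) ^ 2 * (c * v) < 1 → DLRMassGapAt 4 3 (βW / 9)) ∧
      ((14223 / 1000 * (βW / 9)) ^ 2 * (c * v) < 1 →
          CrossoverLedger.StrongCouplingFront (fundamentalLatticeRep 3) (βW / 3)) ∧
        ((14 * (βW / 9)) ^ 2 * (c * v) < 1 →
          CrossoverLedger.LatticeMassGap (fundamentalRep (Fin 3)) (βW / 3)
            (krRate (14 * (βW / 9) * Real.sqrt (c * v)))) := by
  have e : βW / 3 / ((3 : ℕ) : ℝ) * 6 = 2 * βW / 3 := by push_cast; ring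
  have e9 : βW / 3 / ((3 : ℕ) : ℝ) = βW / 9 := by push_cast; ring
  have h := strongCouplingFronts_SU_of_poincare_of_varianceBound (N := 3) (β := βW / 3) (by norm_num)
    (by positivity) hc hv0 (by rw [e]; exact hP) (by rw [e]; exact hv)
  rw [e9] at h
  exact ⟨fun hd => h.1 (mul_sqrt_lt_one (by positivity) hd), fun hd => h.2.1 (mul_sqrt_lt_one (by positivity) hd),
    fun hd => h.2.2 (mul_sqrt_lt_one (by positivity) hd)⟩

/-! ## 3. `SU(3)`: what a certified Poincaré constant would give (CONDITIONAL, both hypotheses displayed) -/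

/-- **`SU(3)`, CONDITIONAL**: IF the one-link Poincaré constant on the ball `‖B‖_op ≤ 1/3` is at most `3/5` (spectral
gap `≥ 5/3`; Haar `8/3`, Bakry–Émery gives only `1/(3·(1/6)) = 2`) AND the linear variance bound there is at most `5/2`
(Monte Carlo `≈ 2.2`; NOT proved, NOT evidence) THEN at Wilson `β_W = 1/2` (tree coupling `1/6`, 't Hooft `1/18`) the
volume-uniform front SC-b and the transfer-matrix gap SC-c hold.  Door arithmetic: `(14223/18000)² · 3/2 = 0.9366 < 1`,
`(14/18)² · 3/2 = 0.9074 < 1`; SC-a's door `1 · 3/2` is shut there. [folklore] -/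
theorem su3_fronts_half_of_poincare_of_varianceBound (hP : OneLinkPoincareSUN 3 (1 / 3) (3 / 5))
    (hv : OneLinkVarianceBound 3 (1 / 3) (5 / 2)) :
    CrossoverLedger.StrongCouplingFront (fundamentalLatticeRep 3) ((1 / 2 : ℝ) / 3) ∧
      CrossoverLedger.LatticeMassGap (fundamentalRep (Fin 3)) ((1 / 2 : ℝ) / 3)
        (krRate (14 * ((1 / 2 : ℝ) / 9) * Real.sqrt (3 / 5 * (5 / 2)))) := by
  have e : 2 * (1 / 2 : ℝ) / 3 = 1 / 3 := by norm_num
  have h := su3_fronts_of_poincare_of_varianceBound (βW := 1 / 2) (c := 3 / 5) (v := 5 / 2) (by norm_num)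
    (by norm_num) (by norm_num) (by rw [e]; exact hP) (by rw [e]; exact hv)
  exact ⟨h.2.1 (by norm_num), h.2.2 (by norm_num)⟩

/-- **`SU(3)`, CONDITIONAL**: IF `OneLinkPoincareSUN 3 (4/15) (3/5)` (gap `≥ 5/3` on `‖B‖_op ≤ 4/15`; Bakry–Émery
gives `10/7`) AND `OneLinkVarianceBound 3 (4/15) (9/4)` (NOT proved) THEN SC-a (unique DLR state, clustering) at
Wilson `β_W = 2/5` ('t Hooft `2/45`) — against the hypothesis-free (and printed) `β_W < 3/16`.  Door arithmetic:
`(18 · 2/45)² · (27/20) = 0.864 < 1`. [folklore] -/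
theorem su3_dlrMassGapAt_twoFifths_of_poincare_of_varianceBound (hP : OneLinkPoincareSUN 3 (4 / 15) (3 / 5))
    (hv : OneLinkVarianceBound 3 (4 / 15) (9 / 4)) : DLRMassGapAt 4 3 ((2 / 5 : ℝ) / 9) := by
  have e : 2 * (2 / 5 : ℝ) / 3 = 4 / 15 := by norm_num
  have h := su3_fronts_of_poincare_of_varianceBound (βW := 2 / 5) (c := 3 / 5) (v := 9 / 4) (by norm_num)
    (by norm_num) (by norm_num) (by rw [e]; exact hP) (by rw [e]; exact hv)
  exact h.1 (by norm_num)

/-- Numbers of §3 (door arithmetic, the Bakry–Émery values the hypotheses undercut, the Haar floor `3/8` they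
respect, and that the Bakry–Émery constants shut the same doors). [folklore] -/
theorem su3_poincareDoor_numbers :
    (14223 / 1000 * ((1 / 2 : ℝ) / 9)) ^ 2 * (3 / 5 * (5 / 2)) < 1 ∧
      (14 * ((1 / 2 : ℝ) / 9)) ^ 2 * (3 / 5 * (5 / 2)) < 1 ∧
      ¬ (18 * ((1 / 2 : ℝ) / 9)) ^ 2 * (3 / 5 * (5 / 2)) < 1 ∧
      (18 * ((2 / 5 : ℝ) / 9)) ^ 2 * (3 / 5 * (9 / 4)) < 1 ∧
      (1 : ℝ) / (3 * (1 / 2 - 1 / 3)) = 2 ∧ (1 : ℝ) / (3 * (1 / 2 - 4 / 15)) = 10 / 7 ∧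
      (3 : ℝ) / 8 < 3 / 5 ∧ (3 : ℝ) / 5 < 10 / 7 ∧
      ¬ (14 * ((1 / 2 : ℝ) / 9)) ^ 2 * (2 * (5 / 2)) < 1 ∧
      ¬ (18 * ((2 / 5 : ℝ) / 9)) ^ 2 * (10 / 7 * (9 / 4)) < 1 ∧
      (4500 : ℝ) / 20223 < 1 / 2 ∧ (3 : ℝ) / 16 < 2 / 5 := by
  norm_num

end Summit.QuantumFields.BalabanUV.InfraRed.StrongCouplingPoincareDoorSUN
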